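import Mathlib
import Summits.Ventures.PercRepro2.HCov
import Summits.Ventures.PercRepro2.RootLeafUTheorem
import Summits.Ventures.PercRepro2.RootLeafUSecond
import Summits.Ventures.PercRepro2.HCovOHalf
import Summits.Ventures.PercRepro2.RootLeafUHalf

/-!
# (G4-u): the sign of record split by the side of `o` — `X5 = X5oL + X5oK` (blind cell PercRepro2, p4 g5;
proofs/P4-G5-STRUCTURE.md §6)

With the o-side splits `T2 = T2oL + T2oK` (RootLeafUHalf) and `Gc(a₁ := u) = GcOL + GcOK` (HCovOHalf)
and `Z·T2 = Gc(a₁ := u) + X5` (RootLeafUSecond), the residual `X5` splits into the two one-sided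
residuals `X5oL := Z·T2oL − GcOL(a₁ := u)` and `X5oK := Z·T2oK − GcOK(a₁ := u)`: **`X5 = X5oL + X5oK`**.
Census (kit j245975 + local, 4,800 leaf instances): `0 ≤ X5oL` and `0 ≤ X5oK` with 0 violations — the
sign of record of (G4-u) is the sum of two one-sided signs (`X5_nonneg_of_halves`); the half with
`o ∈ C₂` carries the world-0 o-mass `e0·ℰ`, the half with `o ∈ C₁` none.
-/

namespace Summit.Ventures.PercRepro2

open UnionCluster CovForm

namespace RootLeafU

variable {V : Type*} {E : Type*} [Fintype E] [DecidableEq E] [Fintype V] [DecidableEq V]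
  {R : Type*} [Field R] [LinearOrder R] [IsStrictOrderedRing R]

section HalfX5

variable (p : E → R) (ends : E → Sym2 V) (o a₂ c b u : V)

/-- **The `o ∈ L` half of the residual**: `X5oL = Z·T2oL − GcOL(a₁ := u)`. -/
noncomputable def X5oL : R :=
  prob p (avoidAll ends a₂ {u}) * T2oL p ends o a₂ c b u - OHalf.GcOL p ends o u a₂ c b

/-- **The `o ∈ K` half of the residual**: `X5oK = Z·T2oK − GcOK(a₁ := u)`. -/
noncomputable def X5oK : R :=
  prob p (avoidAll ends a₂ {u}) * T2oK p ends o a₂ c b u - OHalf.GcOK p ends o u a₂ c b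

omit [LinearOrder R] [IsStrictOrderedRing R] in
/-- **The o-side split of the residual**: `X5 = X5oL + X5oK`. -/
theorem X5_eq_X5oL_add_X5oK :
    X5 p ends o a₂ c b u = X5oL p ends o a₂ c b u + X5oK p ends o a₂ c b u := by
  have h1 := Z_mul_T2_eq p ends o a₂ c b u
  have h2 := T2_eq_T2oL_add_T2oK p ends o a₂ c b u
  have h3 := OHalf.Gc_eq_GcOL_add_GcOK p ends o u a₂ c b
  unfold X5oL X5oK
  linear_combination (-1 : R) * h1 + prob p (avoidAll ends a₂ {u}) * h2 - h3

/-- **`0 ≤ X5` from the two one-sided residual signs**. -/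
theorem X5_nonneg_of_halves (hL : 0 ≤ X5oL p ends o a₂ c b u) (hK : 0 ≤ X5oK p ends o a₂ c b u) :
    0 ≤ X5 p ends o a₂ c b u := by
  rw [X5_eq_X5oL_add_X5oK]
  exact add_nonneg hL hK

/-- **(G4-u) from the two one-sided residual signs and the induction hypothesis.** -/
theorem HCov_root_leaf_u_of_halves (hp : IsProbVec p) {f : E} {a₁ : V} (hf : ends f = s(a₁, u))
    (hleaf : ∀ e, a₁ ∈ ends e → e = f) (h1u : a₁ ≠ u) (h12 : a₁ ≠ a₂)
    (h1c : a₁ ≠ c) (h1o : a₁ ≠ o) (h1b : a₁ ≠ b) (hL : 0 ≤ X5oL p ends o a₂ c b u)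
    (hK : 0 ≤ X5oK p ends o a₂ c b u) (h3 : HCov p ends o u a₂ c b) : HCov p ends o a₁ a₂ c b :=
  HCov_root_leaf_u_of_X5 p ends o a₂ c b u hp hf hleaf h1u h12 h1c h1o h1b
    (X5_nonneg_of_halves p ends o a₂ c b u hL hK) h3

end HalfX5

end RootLeafU

end Summit.Ventures.PercRepro2
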